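import Summits.Ventures.YMGap.RobustBall.LocalSourceScreeningBall
import Summits.Ventures.YMGap.RobustBall.LoopActionFiniteRange
import Summits.Ventures.YMGap.RobustBall.WalkTranslation
import HarnessLib

/-!
# Venture YMGap, track ROBUST-BALL (Y2) — WILSON-LOOP SOURCES ARE SCREENED AT THE CLUSTERING RATE,
# uniformly on the tier-1 ball

HONEST FRAMING. WHAT THIS IS: a venture file (cell `pub-ymgap`, track Y2 ROBUST-BALL, seat rb-p1, theorems only): the
screening estimate of `LocalSourceScreening[Metric|Ball].lean` for the CONCRETE source class of generic Wilson-type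
loop insertions — rb-p1's loop-family action `loopFamilyAction N γ c = Σ_i c_i · Re tr(U_{γ_i})/N` over ANY family
`γ : ι → ZdLoop d` of closed lattice loops with finite carrier fibres, finitely many loops through a link and loops of
finite extent, with couplings `c` of ANY size (`‖c‖₀ ≤ ε_V`, `ε_V` arbitrary: per-link source strength), inserted into
the action of a member `(W, supp)` of the ball.  The loads of such a source vanish off any finite link set `S`
containing the carriers (`loopSource_load_eq_zero`), so:
* `abs_integral_sub_integral_le_of_loopSource` — member a Dobrushin contraction over `perturbedNbr supp`
  (rows `≤ ρ < 1`, range `R`): for every DLR state `μ` of the member, EVERY DLR state `ν` of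
  `W + loopFamilyAction N γ c`, every Lipschitz cylinder `F` (`Λ`, `K_F`):
  `|∫ F dμ − ∫ F dν| ≤ (√N/2 · min(2ε_V, 4))/(1 − max(ρ,½)) · e^{κ} · e^{−(κ/max(1,R)) d(Λ,S)} · #Λ · K_F`, `κ = −log max(ρ,½)`;
* `su2_loopSource_dim4` — `SU(2)`, `ℤ⁴`, the closed-form door `6|β_W| e^{ε₀} + e^{ε₀/2} √(2/3) ε₁ ≤ ρ`, `1/2 ≤ ρ < 1`,
  uniformly on `MemBallZd ε₀ ε₁ R`: `√2 · min(2ε_V,4)/(1 − ρ) · e^{−((1−ρ)/max(1,R)) d(Λ,S)} · #Λ · K_F`;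
* THE WILSON POINT `su2_wilson_loopSource_upTo_oneTwelfth`: `0 ≤ β_W ≤ 1/12`, ANY loop insertion
  `exp(Σ_i c_i Re tr U_{γ_i}/2)` of ANY strength into the `SU(2)` Wilson measure on `ℤ⁴`: every Wilson DLR state `μ`
  and every DLR state `ν` of the modified action satisfy
  `|∫ F dμ − ∫ F dν| ≤ √2 · min(2ε_V, 4) · 2^{−⌊d(Λ,S)⌋} · #Λ · K_F ≤ 4√2 · 2^{−⌊d(Λ,S)⌋} · #Λ · K_F`.
READING (class K): the polarisation cloud of a static Wilson-loop source has thickness at most the certified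
correlation length `max(1,R)/κ`, whatever the strength of the source, for every member of the ball.
WHAT THIS IS NOT: a one-sided Dobrushin-comparison bound; nothing about the expectation OF the inserted loop (area /
perimeter law), only about its influence on distant observables; lattice strong coupling only, nothing about the
continuum limit or a Clay-sense mass gap.
-/

noncomputable section

open MeasureTheory Filter Function ProbabilityTheory Real Topology
open scoped NNReal
open Literature.Probability.LatticeModels
open Literature.Probability.LatticeModels.DobrushinMetric
open Literature.MathematicalPhysics.QuantumLattice
open Literature.MathematicalPhysics.QuantumFieldTheory hiding ZdEdge Site

namespace Summit.Ventures.YMGap.RobustBall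

variable {d N : ℕ} {ι : Type*}

/-! ### The loads of a loop-family source vanish off the carriers -/

/-- **Off the carriers a loop-family source does not load**: if every carrier `walkEdges (γ i).walk` lies in `S` and
`e ∉ S`, no set of the support family `loopSupp γ {e}` contains `e`, so every per-link load sum at `e` vanishes. -/
theorem loopSource_load_eq_zero {γ : ι → ZdLoop d} (hthr : ∀ e : ZdEdge d, {i | e ∈ walkEdges (γ i).walk}.Finite)
    {S : Finset (ZdEdge d)} (hS : ∀ i, walkEdges (γ i).walk ⊆ S) (osc : Finset (ZdEdge d) → ZdEdge d → ℝ)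
    {e : ZdEdge d} (he : e ∉ S) :
    ∑ X ∈ (loopSupp γ {e}).filter (fun X => e ∈ X), osc X e = 0 := by
  refine Finset.sum_eq_zero fun X hX => ?_
  exfalso
  rw [Finset.mem_filter] at hX
  obtain ⟨i, hi, -⟩ := (mem_indexedSupp_iff (code := fun i => walkEdges (γ i).walk) hthr).1 hX.1
  exact he (hS i (hi ▸ hX.2))

/-! ### Screening of a loop-family source: any door -/

/-- **WILSON-LOOP SOURCES ARE SCREENED AT THE CLUSTERING RATE (any door).**  Member `(W, supp)`: a Dobrushin
contraction over `perturbedNbr supp` with rows `≤ ρ < 1`, range `R`.  Source: the loop-family action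
`loopFamilyAction N γ c` of any loop family with finite carrier fibres, finitely many loops through a link, loops of
extent `≤ R_V` (`R_V` arbitrary, absent from the bound) and `‖c‖₀ ≤ ε_V` (`ε_V` arbitrary), all carriers inside the
finite link set `S`.  Then every DLR state `μ` of the member and EVERY DLR state `ν` of `W + loopFamilyAction N γ c`
satisfy, for every Lipschitz cylinder `F` (`Λ`, `K_F`):
`|∫ F dμ − ∫ F dν| ≤ (√N/2 · min(2ε_V,4))/(1 − max(ρ,½)) · e^{κ} · e^{−(κ/max(1,R)) d(Λ,S)} · #Λ · K_F`. -/
theorem abs_integral_sub_integral_le_of_loopSource (hd : 1 ≤ d) {β ρ R : ℝ}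
    {W : Potential (ZdEdge d) (Matrix.specialUnitaryGroup (Fin N) ℂ)} (hW : W.IsAdapted)
    (hWb : ∀ X, ∃ C, ∀ U, |W X U| ≤ C)
    {supp : Finset (ZdEdge d) → Finset (Finset (ZdEdge d))} (hsupp : W.IsSupportedBy supp)
    (hR : ∀ e, ∀ X ∈ supp {e}, e ∈ X → ∀ y ∈ X, ‖e.1 - y.1‖ ≤ R)
    {C : ZdEdge d → ZdEdge d → ℝ}
    (hKR : IsKRContraction (perturbedYM (d := d) (fundamentalRep (Fin N)) (N * β) W supp) suFrobDist
      (perturbedNbr supp) C)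
    (hrow : ∀ x, ∑ y ∈ perturbedNbr supp x, C x y ≤ ρ) (hρ : ρ < 1)
    {γ : ι → ZdLoop d} {c : ι → ℝ} (hfin : ∀ X, {i | walkEdges (γ i).walk = X}.Finite)
    (hthr : ∀ e : ZdEdge d, {i | e ∈ walkEdges (γ i).walk}.Finite) {RV εV : ℝ}
    (hRV : ∀ i, ∀ e ∈ walkEdges (γ i).walk, ∀ y ∈ walkEdges (γ i).walk, ‖e.1 - y.1‖ ≤ RV)
    (hnorm : LoopNormLE 0 γ c εV) {S : Finset (ZdEdge d)} (hS : ∀ i, walkEdges (γ i).walk ⊆ S)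
    {μ ν : Measure (LGConfig d (Matrix.specialUnitaryGroup (Fin N) ℂ))}
    (hμ : μ ∈ perturbedGibbsMeasures (d := d) (fundamentalRep (Fin N)) (N * β) W supp)
    (hν : ν ∈ perturbedGibbsMeasures (d := d) (fundamentalRep (Fin N)) (N * β) (W + loopFamilyAction N γ c)
      (fun Λ => supp Λ ∪ loopSupp γ Λ))
    {F : LGConfig d (Matrix.specialUnitaryGroup (Fin N) ℂ) → ℝ} {Λ : Finset (ZdEdge d)} {KF : ℝ≥0}
    (hF : IsLipschitzCylinder (fundamentalRep (Fin N)) F Λ KF) :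
    |(∫ σ, F σ ∂μ) - ∫ σ, F σ ∂ν| ≤
      Real.sqrt N / 2 * min (2 * εV) 4 / (1 - max ρ (1 / 2)) * exp (-Real.log (max ρ (1 / 2))) *
        exp (-(-Real.log (max ρ (1 / 2)) / max 1 R) * setDistEdges Λ S) * (Λ.card * KF) := by
  haveI : SecondCountableTopology (Matrix (Fin N) (Fin N) ℂ) :=
    inferInstanceAs (SecondCountableTopology (Fin N → Fin N → ℂ))
  haveI : SecondCountableTopology (Matrix.specialUnitaryGroup (Fin N) ℂ) :=
    Topology.IsEmbedding.subtypeVal.secondCountableTopology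
  -- the source is a tier-1 member of radius `(2ε_V, ε_V)`: adapted, bounded, listed, with per-link loads `≤ 2ε_V`
  have hmemV : MemBallZd (2 * εV) εV RV (loopFamilyAction (d := d) N γ c) (loopSupp γ) :=
    memBallZd_loopFamilyAction hfin hthr hRV hnorm
  obtain ⟨oscV, lipV, hoscV, -, hoscaV, -⟩ := hmemV.loads
  have hV : (loopFamilyAction (d := d) N γ c).IsAdapted :=
    fun X => ⟨hmemV.dependsOn X, (hmemV.continuous X).measurable⟩
  have hVb : ∀ X, ∃ C, ∀ U, |loopFamilyAction (d := d) N γ c X U| ≤ C :=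
    fun X => exists_bound_of_continuous (hmemV.continuous X)
  have hS' : ∀ e, e ∉ S → ∑ X ∈ (loopSupp γ {e}).filter (fun X => e ∈ X), oscV X e ≤ 0 :=
    fun e he => (loopSource_load_eq_zero hthr hS oscV he).le
  exact abs_integral_sub_integral_le_of_source_cylinder hd hW hWb hsupp hR hKR hrow hρ hV hVb hmemV.supportedBy hoscV
    (bV := fun e => ∑ X ∈ (loopSupp γ {e}).filter (fun X => e ∈ X), oscV X e) (fun e => le_rfl) hoscaV hS' hμ hν hF

/-! ### `SU(2)`, `ℤ⁴`: the closed-form door, uniformly on the ball -/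

/-- **`SU(2)`, `ℤ⁴` — Wilson-loop sources are screened uniformly on the tier-1 ball.**
`6|β_W| e^{ε₀} + e^{ε₀/2} √(2/3) ε₁ ≤ ρ`, `1/2 ≤ ρ < 1`: for every member of `MemBallZd ε₀ ε₁ R` (bare coupling `β_W/2`),
every loop-family source as above (strength `ε_V` arbitrary, carriers inside `S`), every DLR state `μ` of the member
and `ν` of the member with the loops inserted, every Lipschitz cylinder `F` (`Λ`, `K_F`):
`|∫ F dμ − ∫ F dν| ≤ √2 · min(2ε_V,4)/(1 − ρ) · e^{−((1−ρ)/max(1,R)) d(Λ,S)} · #Λ · K_F`. -/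
theorem su2_loopSource_dim4 {βW ε₀ ε₁ ρ R : ℝ}
    (hρ : 6 * |βW| * exp ε₀ + exp (ε₀ / 2) * Real.sqrt (2 / 3) * ε₁ ≤ ρ) (hhalf : 1 / 2 ≤ ρ) (hρ1 : ρ < 1)
    {W : Potential (ZdEdge 4) (Matrix.specialUnitaryGroup (Fin 2) ℂ)}
    {supp : Finset (ZdEdge 4) → Finset (Finset (ZdEdge 4))} (hmem : MemBallZd ε₀ ε₁ R W supp)
    {γ : ι → ZdLoop 4} {c : ι → ℝ} (hfin : ∀ X, {i | walkEdges (γ i).walk = X}.Finite)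
    (hthr : ∀ e : ZdEdge 4, {i | e ∈ walkEdges (γ i).walk}.Finite) {RV εV : ℝ}
    (hRV : ∀ i, ∀ e ∈ walkEdges (γ i).walk, ∀ y ∈ walkEdges (γ i).walk, ‖e.1 - y.1‖ ≤ RV)
    (hnorm : LoopNormLE 0 γ c εV) {S : Finset (ZdEdge 4)} (hS : ∀ i, walkEdges (γ i).walk ⊆ S)
    {μ ν : Measure (LGConfig 4 (Matrix.specialUnitaryGroup (Fin 2) ℂ))}
    (hμ : μ ∈ perturbedGibbsMeasures (d := 4) (fundamentalRep (Fin 2)) (2 * (βW / 4)) W supp)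
    (hν : ν ∈ perturbedGibbsMeasures (d := 4) (fundamentalRep (Fin 2)) (2 * (βW / 4)) (W + loopFamilyAction 2 γ c)
      (fun Λ => supp Λ ∪ loopSupp γ Λ))
    {F : LGConfig 4 (Matrix.specialUnitaryGroup (Fin 2) ℂ) → ℝ} {Λ : Finset (ZdEdge 4)} {KF : ℝ≥0}
    (hF : IsLipschitzCylinder (fundamentalRep (Fin 2)) F Λ KF) :
    |(∫ σ, F σ ∂μ) - ∫ σ, F σ ∂ν| ≤
      Real.sqrt 2 * min (2 * εV) 4 / (1 - ρ) * exp (-((1 - ρ) / max 1 R) * setDistEdges Λ S) * (Λ.card * KF) := by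
  haveI : SecondCountableTopology (Matrix (Fin 2) (Fin 2) ℂ) :=
    inferInstanceAs (SecondCountableTopology (Fin 2 → Fin 2 → ℂ))
  haveI : SecondCountableTopology (Matrix.specialUnitaryGroup (Fin 2) ℂ) :=
    Topology.IsEmbedding.subtypeVal.secondCountableTopology
  have hmemV : MemBallZd (2 * εV) εV RV (loopFamilyAction (d := 4) 2 γ c) (loopSupp γ) :=
    memBallZd_loopFamilyAction hfin hthr hRV hnorm
  obtain ⟨oscV, lipV, hoscV, -, hoscaV, -⟩ := hmemV.loads
  have hV : (loopFamilyAction (d := 4) 2 γ c).IsAdapted :=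
    fun X => ⟨hmemV.dependsOn X, (hmemV.continuous X).measurable⟩
  have hVb : ∀ X, ∃ C, ∀ U, |loopFamilyAction (d := 4) 2 γ c X U| ≤ C :=
    fun X => exists_bound_of_continuous (hmemV.continuous X)
  have hS' : ∀ e, e ∉ S → ∑ X ∈ (loopSupp γ {e}).filter (fun X => e ∈ X), oscV X e ≤ 0 :=
    fun e he => (loopSource_load_eq_zero hthr hS oscV he).le
  exact su2_localScreening_dim4 hρ hhalf hρ1 hmem hV hVb hmemV.supportedBy hoscV
    (bV := fun e => ∑ X ∈ (loopSupp γ {e}).filter (fun X => e ∈ X), oscV X e) (fun e => le_rfl) hoscaV hS' hμ hν hF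

/-- **Cell `(β_W; ε₀, ε₁) = (1/8; 1/10, 1/20)`** (row sum `≤ 7/8`): on `MemBallZd (1/10) (1/20) R` at `β_W = 1/8` every
Wilson-loop source family of per-link strength `ε_V` inside `S` is screened at rate `(1/8)/max(1,R)`:
`|∫ F dμ − ∫ F dν| ≤ 8√2 · min(2ε_V,4) · e^{−((1/8)/max(1,R)) d(Λ,S)} · #Λ · K_F`. -/
theorem su2_loopSource_1_8 {R : ℝ}
    {W : Potential (ZdEdge 4) (Matrix.specialUnitaryGroup (Fin 2) ℂ)}
    {supp : Finset (ZdEdge 4) → Finset (Finset (ZdEdge 4))} (hmem : MemBallZd (1 / 10) (1 / 20) R W supp)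
    {γ : ι → ZdLoop 4} {c : ι → ℝ} (hfin : ∀ X, {i | walkEdges (γ i).walk = X}.Finite)
    (hthr : ∀ e : ZdEdge 4, {i | e ∈ walkEdges (γ i).walk}.Finite) {RV εV : ℝ}
    (hRV : ∀ i, ∀ e ∈ walkEdges (γ i).walk, ∀ y ∈ walkEdges (γ i).walk, ‖e.1 - y.1‖ ≤ RV)
    (hnorm : LoopNormLE 0 γ c εV) {S : Finset (ZdEdge 4)} (hS : ∀ i, walkEdges (γ i).walk ⊆ S)
    {μ ν : Measure (LGConfig 4 (Matrix.specialUnitaryGroup (Fin 2) ℂ))}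
    (hμ : μ ∈ perturbedGibbsMeasures (d := 4) (fundamentalRep (Fin 2)) (2 * ((1 / 8 : ℝ) / 4)) W supp)
    (hν : ν ∈ perturbedGibbsMeasures (d := 4) (fundamentalRep (Fin 2)) (2 * ((1 / 8 : ℝ) / 4))
      (W + loopFamilyAction 2 γ c) (fun Λ => supp Λ ∪ loopSupp γ Λ))
    {F : LGConfig 4 (Matrix.specialUnitaryGroup (Fin 2) ℂ) → ℝ} {Λ : Finset (ZdEdge 4)} {KF : ℝ≥0}
    (hF : IsLipschitzCylinder (fundamentalRep (Fin 2)) F Λ KF) :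
    |(∫ σ, F σ ∂μ) - ∫ σ, F σ ∂ν| ≤
      8 * Real.sqrt 2 * min (2 * εV) 4 * exp (-((1 / 8) / max 1 R) * setDistEdges Λ S) * (Λ.card * KF) := by
  have hρ : 6 * |(1 / 8 : ℝ)| * exp (1 / 10) + exp (1 / 10 / 2) * Real.sqrt (2 / 3) * (1 / 20) ≤ 7 / 8 := by
    have h1 := exp_le_taylor4 (x := (1 / 10 : ℝ)) (by norm_num) (by norm_num)
    have h2 := exp_le_taylor4 (x := (1 / 10 : ℝ) / 2) (by norm_num) (by norm_num)
    rw [abs_of_nonneg (by norm_num : (0 : ℝ) ≤ 1 / 8)]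
    calc 6 * (1 / 8 : ℝ) * exp (1 / 10) + exp (1 / 10 / 2) * Real.sqrt (2 / 3) * (1 / 20)
        ≤ 6 * (1 / 8 : ℝ) * (1 + 1 / 10 + (1 / 10) ^ 2 / 2 + (1 / 10) ^ 3 / 6 + 5 / 96 * (1 / 10) ^ 4) +
          (1 + 1 / 10 / 2 + (1 / 10 / 2) ^ 2 / 2 + (1 / 10 / 2) ^ 3 / 6 + 5 / 96 * (1 / 10 / 2) ^ 4) *
            (8165 / 10000) * (1 / 20) := by
          gcongr
          · exact sqrt_two_thirds_le
      _ ≤ 7 / 8 := by norm_num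
  have key := su2_loopSource_dim4 hρ (by norm_num) (by norm_num) hmem hfin hthr hRV hnorm hS hμ hν hF
  refine key.trans (le_of_eq ?_)
  rw [show (1 : ℝ) - 7 / 8 = 1 / 8 by norm_num]
  ring

/-! ### The Wilson point: loop insertions into the pure `SU(2)` Wilson measure on `ℤ⁴` -/

/-- **THE WILSON POINT: ANY WILSON-LOOP INSERTION IS SCREENED AT RATE `log 2`.**  For `0 ≤ β_W ≤ 1/12`, any loop
family `γ` (finite carrier fibres, finitely many loops through a link, loops of finite extent `≤ R_V`) with couplings
of ANY size (`‖c‖₀ ≤ ε_V`), carriers inside the finite link set `S`: every DLR state `μ` of the `SU(2)` Wilson action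
on `ℤ⁴` (bare coupling `β_W/2`) and EVERY DLR state `ν` of the action with the loops `Σ_i c_i Re tr U_{γ_i}/2`
inserted satisfy, for every Lipschitz cylinder `F` (`Λ`, `K_F`),
`|∫ F dμ − ∫ F dν| ≤ √2 · min(2ε_V, 4) · 2^{−⌊d(Λ,S)⌋} · #Λ · K_F` (`≤ 4√2 · 2^{−⌊d(Λ,S)⌋} · #Λ · K_F` whatever the strength). -/
theorem su2_wilson_loopSource_upTo_oneTwelfth {βW : ℝ} (h0 : 0 ≤ βW) (h : βW ≤ 1 / 12)
    {γ : ι → ZdLoop 4} {c : ι → ℝ} (hfin : ∀ X, {i | walkEdges (γ i).walk = X}.Finite)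
    (hthr : ∀ e : ZdEdge 4, {i | e ∈ walkEdges (γ i).walk}.Finite) {RV εV : ℝ}
    (hRV : ∀ i, ∀ e ∈ walkEdges (γ i).walk, ∀ y ∈ walkEdges (γ i).walk, ‖e.1 - y.1‖ ≤ RV)
    (hnorm : LoopNormLE 0 γ c εV) {S : Finset (ZdEdge 4)} (hS : ∀ i, walkEdges (γ i).walk ⊆ S)
    {μ ν : Measure (LGConfig 4 (Matrix.specialUnitaryGroup (Fin 2) ℂ))}
    (hμ : μ ∈ ymGibbsMeasures (d := 4) (fundamentalRep (Fin 2)) (2 * (βW / 4)))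
    (hν : ν ∈ perturbedGibbsMeasures (d := 4) (fundamentalRep (Fin 2)) (2 * (βW / 4)) (loopFamilyAction 2 γ c)
      (loopSupp γ))
    {F : LGConfig 4 (Matrix.specialUnitaryGroup (Fin 2) ℂ) → ℝ} {Λ : Finset (ZdEdge 4)} {KF : ℝ≥0}
    (hF : IsLipschitzCylinder (fundamentalRep (Fin 2)) F Λ KF) :
    |(∫ σ, F σ ∂μ) - ∫ σ, F σ ∂ν| ≤
      Real.sqrt 2 * min (2 * εV) 4 * (1 / 2) ^ ⌊setDistEdges Λ S⌋₊ * (Λ.card * KF) := by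
  haveI : SecondCountableTopology (Matrix (Fin 2) (Fin 2) ℂ) :=
    inferInstanceAs (SecondCountableTopology (Fin 2 → Fin 2 → ℂ))
  haveI : SecondCountableTopology (Matrix.specialUnitaryGroup (Fin 2) ℂ) :=
    Topology.IsEmbedding.subtypeVal.secondCountableTopology
  have hmemV : MemBallZd (2 * εV) εV RV (loopFamilyAction (d := 4) 2 γ c) (loopSupp γ) :=
    memBallZd_loopFamilyAction hfin hthr hRV hnorm
  obtain ⟨oscV, lipV, hoscV, -, hoscaV, -⟩ := hmemV.loads
  have hV : (loopFamilyAction (d := 4) 2 γ c).IsAdapted :=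
    fun X => ⟨hmemV.dependsOn X, (hmemV.continuous X).measurable⟩
  have hVb : ∀ X, ∃ C, ∀ U, |loopFamilyAction (d := 4) 2 γ c X U| ≤ C :=
    fun X => exists_bound_of_continuous (hmemV.continuous X)
  have hS' : ∀ e, e ∉ S → ∑ X ∈ (loopSupp γ {e}).filter (fun X => e ∈ X), oscV X e ≤ 0 :=
    fun e he => (loopSource_load_eq_zero hthr hS oscV he).le
  exact su2_wilson_localScreening_upTo_oneTwelfth h0 h hV hVb hmemV.supportedBy hoscV
    (bV := fun e => ∑ X ∈ (loopSupp γ {e}).filter (fun X => e ∈ X), oscV X e) (fun e => le_rfl) hoscaV hS' hμ hν hF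

/-- **Strength-free reading at the Wilson point**: whatever the couplings of the inserted loops,
`|∫ F dμ − ∫ F dν| ≤ 4√2 · 2^{−⌊d(Λ,S)⌋} · #Λ · K_F` (`min(2ε_V, 4) ≤ 4`). -/
theorem su2_wilson_loopSource_upTo_oneTwelfth' {βW : ℝ} (h0 : 0 ≤ βW) (h : βW ≤ 1 / 12)
    {γ : ι → ZdLoop 4} {c : ι → ℝ} (hfin : ∀ X, {i | walkEdges (γ i).walk = X}.Finite)
    (hthr : ∀ e : ZdEdge 4, {i | e ∈ walkEdges (γ i).walk}.Finite) {RV εV : ℝ}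
    (hRV : ∀ i, ∀ e ∈ walkEdges (γ i).walk, ∀ y ∈ walkEdges (γ i).walk, ‖e.1 - y.1‖ ≤ RV)
    (hnorm : LoopNormLE 0 γ c εV) {S : Finset (ZdEdge 4)} (hS : ∀ i, walkEdges (γ i).walk ⊆ S)
    {μ ν : Measure (LGConfig 4 (Matrix.specialUnitaryGroup (Fin 2) ℂ))}
    (hμ : μ ∈ ymGibbsMeasures (d := 4) (fundamentalRep (Fin 2)) (2 * (βW / 4)))
    (hν : ν ∈ perturbedGibbsMeasures (d := 4) (fundamentalRep (Fin 2)) (2 * (βW / 4)) (loopFamilyAction 2 γ c)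
      (loopSupp γ))
    {F : LGConfig 4 (Matrix.specialUnitaryGroup (Fin 2) ℂ) → ℝ} {Λ : Finset (ZdEdge 4)} {KF : ℝ≥0}
    (hF : IsLipschitzCylinder (fundamentalRep (Fin 2)) F Λ KF) :
    |(∫ σ, F σ ∂μ) - ∫ σ, F σ ∂ν| ≤ 4 * Real.sqrt 2 * (1 / 2) ^ ⌊setDistEdges Λ S⌋₊ * (Λ.card * KF) := by
  have key := su2_wilson_loopSource_upTo_oneTwelfth h0 h hfin hthr hRV hnorm hS hμ hν hF
  refine key.trans ?_
  have hmin : min (2 * εV) 4 ≤ 4 := min_le_right _ _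
  have hpos : (0 : ℝ) ≤ (1 / 2) ^ ⌊setDistEdges Λ S⌋₊ * (Λ.card * KF) := by positivity
  calc Real.sqrt 2 * min (2 * εV) 4 * (1 / 2) ^ ⌊setDistEdges Λ S⌋₊ * (Λ.card * KF)
      = Real.sqrt 2 * min (2 * εV) 4 * ((1 / 2) ^ ⌊setDistEdges Λ S⌋₊ * (Λ.card * KF)) := by ring
    _ ≤ Real.sqrt 2 * 4 * ((1 / 2) ^ ⌊setDistEdges Λ S⌋₊ * (Λ.card * KF)) :=
        mul_le_mul_of_nonneg_right (mul_le_mul_of_nonneg_left hmin (Real.sqrt_nonneg _)) hpos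
    _ = 4 * Real.sqrt 2 * (1 / 2) ^ ⌊setDistEdges Λ S⌋₊ * (Λ.card * KF) := by ring

/-! ### One Wilson loop of any strength -/

/-- A single closed walk with coupling `t` has loop-action norm `‖c‖₀ ≤ |t| · |w|` (`|w|` = the length). -/
theorem loopNormLE_single {d : ℕ} {x : Site d} (w : (zdGraph d).Walk x x) (t : ℝ) :
    LoopNormLE 0 (fun _ : Unit => (⟨x, w⟩ : ZdLoop d)) (fun _ => t) (|t| * w.length) := by
  have hle : ∀ e : ZdEdge d, loopWeightAt 0 (fun _ : Unit => (⟨x, w⟩ : ZdLoop d)) (fun _ => t) e () ≤ |t| * w.length := by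
    intro e
    unfold loopWeightAt
    split_ifs
    · simp only [zero_mul, Real.exp_zero, mul_one]
      rw [← Nat.cast_sum, sum_walkEdges_dartMult]
    · positivity
  refine ⟨by positivity, fun e => (hasSum_fintype _).summable, fun e => ?_⟩
  rw [tsum_fintype, Fintype.sum_unique]
  exact hle e

/-- **THE WILSON POINT, ONE LOOP OF ANY STRENGTH.**  For `0 ≤ β_W ≤ 1/12`, any closed lattice walk `w` in `ℤ⁴` and
ANY real `t`: every DLR state `μ` of the `SU(2)` Wilson action (bare coupling `β_W/2`) and EVERY DLR state `ν` of the
action with the Wilson-loop source `t · Re tr U_w / 2` inserted (the loop-family action of the one-member family)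
satisfy, for every Lipschitz cylinder `F` (`Λ`, `K_F`):
`|∫ F dμ − ∫ F dν| ≤ 4√2 · 2^{−⌊d(Λ, w)⌋} · #Λ · K_F`, `d(Λ, w)` the `ℓ^∞` distance from the links of `F` to the links
of the loop — the constant does not see `t`. -/
theorem su2_wilson_singleLoop_upTo_oneTwelfth {βW : ℝ} (h0 : 0 ≤ βW) (h : βW ≤ 1 / 12) {x : Site 4}
    (w : (zdGraph 4).Walk x x) (t : ℝ)
    {μ ν : Measure (LGConfig 4 (Matrix.specialUnitaryGroup (Fin 2) ℂ))}
    (hμ : μ ∈ ymGibbsMeasures (d := 4) (fundamentalRep (Fin 2)) (2 * (βW / 4)))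
    (hν : ν ∈ perturbedGibbsMeasures (d := 4) (fundamentalRep (Fin 2)) (2 * (βW / 4))
      (loopFamilyAction 2 (fun _ : Unit => (⟨x, w⟩ : ZdLoop 4)) (fun _ => t))
      (loopSupp (fun _ : Unit => (⟨x, w⟩ : ZdLoop 4))))
    {F : LGConfig 4 (Matrix.specialUnitaryGroup (Fin 2) ℂ) → ℝ} {Λ : Finset (ZdEdge 4)} {KF : ℝ≥0}
    (hF : IsLipschitzCylinder (fundamentalRep (Fin 2)) F Λ KF) :
    |(∫ σ, F σ ∂μ) - ∫ σ, F σ ∂ν| ≤ 4 * Real.sqrt 2 * (1 / 2) ^ ⌊setDistEdges Λ (walkEdges w)⌋₊ * (Λ.card * KF) :=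
  su2_wilson_loopSource_upTo_oneTwelfth' h0 h (γ := fun _ : Unit => (⟨x, w⟩ : ZdLoop 4)) (c := fun _ => t)
    (fun _ => Set.toFinite _) (fun _ => Set.toFinite _) (RV := 2 * w.length)
    (fun _ _ he _ hy => norm_sub_le_two_mul_length_of_mem_walkEdges w he hy) (loopNormLE_single w t)
    (S := walkEdges w) (fun _ => subset_rfl) hμ hν hF

end Summit.Ventures.YMGap.RobustBall

end
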